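import Literature.RingTheory.Flat.FibrewiseCriterionLemmas
import Literature.RingTheory.Flat.LocalCriterion
import Literature.RingTheory.Flat.FlatLocus
import HarnessLib

/-!
# The fibrewise criterion of flatness at a Noetherian level (Stacks 00MP, abstract form)

The Noetherian step in the proof of the named fact `Stacks05UV` (The Stacks Project, Tags 00MP,
00R7, 05UV), in the abstract form in which the limit argument of Tag 00R7 uses it. The data: a
ring `T` with a prime `𝔭`, a field `k` under `T` with `Ker(T → k) = 𝔭` (in the application:
`T ⊆ R` a finitely generated subring of a local ring `(R, 𝔪, k)`, `𝔭 = 𝔪 ∩ T`), `T`-algebras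
`C → P` (Noetherian; in the application `C = T[x]/(g_T)`, `P = T[x, y]/(F_T)`), a prime `Q ⊆ P`
over `𝔭`, and a `P`-algebra `E` with `E = k ⊗_T P` (the fibre `B′/𝔪B′` of the finitely presented
algebra at level `∞`) which is a FLAT algebra over the level-`T` fibre ring `Λ = C/𝔭C` (this is
where the hypothesis "`B′/𝔪B′` flat over `B/𝔪B`" of Tag 05UV enters).

* `injective_lTensor_localization_fibre` — the fibre condition of the local criterion at level
  `T`: `P_Q ⊗_C 𝔠 → P_Q ⊗_C Λ` is injective for every ideal `𝔠 ⊆ Λ`. Proof: by the torsion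
  description of kernels after localization (`injective_lTensor_iff_forall_exists_smul_eq_zero`)
  it suffices that every `z ∈ Ker(P ⊗_C 𝔠 → P ⊗_C Λ)` is killed by an element of `P ∖ Q`; its
  image in `E ⊗_C 𝔠` vanishes (`E` is `Λ`-flat), and `E ⊗_C 𝔠 = (P ⊗_C 𝔠) ⊗_T k`, so `z ⊗ 1 = 0`
  in `(P ⊗_C 𝔠) ⊗_T k`; since `𝔭` kills `P ⊗_C 𝔠`, some `t ∈ T ∖ 𝔭` kills `z`
  (`exists_smul_eq_zero_of_tmul_one_eq_zero`), and `t ∉ Q`.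
* `flat_localization_of_flat_of_fibre` — **Tag 00MP at level `T`**: if moreover `C`, `P` are
  Noetherian and `P_Q` is flat over `T`, then `P_Q` is flat over `C` — the local criterion
  `flat_of_le_jacobson` over `C` with `J = 𝔭C ↦ 𝔭P_Q ⊆ QP_Q`, `Tor₁^C(C/𝔭C, P_Q) = 0` by the
  `Tor₁` trick of Tag 00MP (`injective_lTensor_subtype_map_of_flat`), and the fibre condition
  above.

## References

* The Stacks Project, Tags 00MP (Lemma 10.99.15), 00R7, 05UV. [StacksProject]
-/

universe u v w u' v'

open TensorProduct

namespace Literature.RingTheory.Flat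

section Level

variable {T : Type u} [CommRing T] (p : Ideal T) [p.IsPrime]
  {C : Type v} [CommRing C] [Algebra T C]
  {P : Type w} [CommRing P] [Algebra T P] [Algebra C P] [IsScalarTower T C P]
  (Q : Ideal P) [Q.IsPrime] (hQ : Q.comap (algebraMap T P) = p)
  {k : Type u'} [Field k] [Algebra T k] (hk : ∀ t, algebraMap T k t = 0 ↔ t ∈ p)
  (E : Type v') [CommRing E] [Algebra P E] [Algebra C E] [Algebra T E] [Algebra k E]
  [IsScalarTower C P E] [IsScalarTower T P E] [IsScalarTower T k E] [Algebra.IsPushout T k P E]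
  [Algebra (C ⧸ p.map (algebraMap T C)) E] [IsScalarTower C (C ⧸ p.map (algebraMap T C)) E]
  [Module.Flat (C ⧸ p.map (algebraMap T C)) E]

include hQ hk E in
/-- **The fibre condition at level `T`.** With the data of this section (`E = k ⊗_T P` flat over
`Λ = C/𝔭C`, `Q ∩ T = 𝔭 = Ker(T → k)`), the map `P_Q ⊗_C 𝔠 → P_Q ⊗_C Λ` is injective for every
ideal `𝔠 ⊆ Λ` — i.e. `P_Q/𝔭P_Q` is flat over `C/𝔭C` in the form consumed by
`flat_of_le_jacobson`. See the module docstring for the proof.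
[cite: StacksProject, Tag 00R7 (proof)] -/
theorem injective_lTensor_localization_fibre (𝔠 : Ideal (C ⧸ p.map (algebraMap T C))) :
    Function.Injective (LinearMap.lTensor (Localization.AtPrime Q)
      (𝔠.subtype.restrictScalars C)) := by
  let Λ := C ⧸ p.map (algebraMap T C)
  let N := Localization.AtPrime Q
  let ι : ↥𝔠 →ₗ[C] Λ := 𝔠.subtype.restrictScalars C
  -- the torsion criterion for the localization `P → P_Q`
  let gN : P →ₗ[P] N := (IsScalarTower.toAlgHom P P N).toLinearMap
  haveI : IsLocalizedModule Q.primeCompl gN :=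
    isLocalizedModule_iff_isLocalization.mpr inferInstance
  rw [injective_lTensor_iff_forall_exists_smul_eq_zero Q.primeCompl gN ι]
  intro z hz
  -- Step A: the image of `z` in `E ⊗_C 𝔠` vanishes, `E` being flat over `Λ`
  have hΛ : Function.Surjective (algebraMap C Λ) := Ideal.Quotient.mk_surjective
  haveI : Module.Flat Λ (Λ ⊗[C] E) := flat_baseChange_of_surjective hΛ E
  have hinjE : Function.Injective (LinearMap.lTensor E ι) :=
    lTensor_injective_of_flat_baseChange (R := C) (N := E) (S := Λ) 𝔠
  let j : P →ₗ[C] E := (IsScalarTower.toAlgHom C P E).toLinearMap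
  have h1 : LinearMap.rTensor (↥𝔠) j z = 0 := by
    apply hinjE
    rw [map_zero, ← LinearMap.comp_apply, LinearMap.lTensor_comp_rTensor,
      ← LinearMap.rTensor_comp_lTensor, LinearMap.comp_apply, LinearMap.mem_ker.mp hz, map_zero]
  -- Step B: `E = P ⊗_T k`, so `z ⊗ 1 = 0` in `(P ⊗_C 𝔠) ⊗_T k`
  haveI : Algebra.IsPushout T P k E := Algebra.IsPushout.symm inferInstance
  let e₁ : P ⊗[T] k ≃ₗ[P] E := (Algebra.IsPushout.equiv T P k E).toLinearEquiv
  let ι₁ : P →ₗ[C] P ⊗[T] k :=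
    (Algebra.TensorProduct.includeLeft : P →ₐ[C] P ⊗[T] k).toLinearMap
  have hj : j = (e₁.restrictScalars C).toLinearMap ∘ₗ ι₁ := by
    apply LinearMap.ext
    intro y
    change algebraMap P E y = Algebra.IsPushout.equiv T P k E (y ⊗ₜ[T] (1 : k))
    rw [Algebra.IsPushout.equiv_tmul, map_one, mul_one]
  have h2 : LinearMap.rTensor (↥𝔠) ι₁ z = 0 := by
    have h : LinearMap.rTensor ↥𝔠 j z =
        (LinearEquiv.rTensor ↥𝔠 (e₁.restrictScalars C)) (LinearMap.rTensor ↥𝔠 ι₁ z) := by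
      rw [hj, LinearMap.rTensor_comp, LinearMap.comp_apply]
      rfl
    rw [h1] at h
    exact (LinearEquiv.rTensor ↥𝔠 (e₁.restrictScalars C)).injective
      (by rw [← h, LinearEquiv.map_zero])
  let rc := TensorProduct.AlgebraTensorModule.rightComm T C P P (↥𝔠) k
  have h3 : ∀ w : P ⊗[C] ↥𝔠, rc (w ⊗ₜ[T] (1 : k)) = LinearMap.rTensor ↥𝔠 ι₁ w := by
    intro w
    induction w using TensorProduct.induction_on with
    | zero => rw [TensorProduct.zero_tmul, LinearEquiv.map_zero, LinearMap.map_zero]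
    | add x y hx hy => rw [TensorProduct.add_tmul, LinearEquiv.map_add, LinearMap.map_add, hx, hy]
    | tmul y c =>
      rw [TensorProduct.AlgebraTensorModule.rightComm_tmul, LinearMap.rTensor_tmul]
      rfl
  have h4 : z ⊗ₜ[T] (1 : k) = 0 := rc.injective (by rw [h3, h2, LinearEquiv.map_zero])
  -- Step C: `𝔭` kills `P ⊗_C 𝔠`, so some `t ∈ T ∖ 𝔭` kills `z`
  have hV : ∀ t ∈ p, ∀ v : P ⊗[C] ↥𝔠, t • v = 0 := by
    intro t ht v
    have hct : algebraMap C Λ (algebraMap T C t) = 0 := by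
      rw [Ideal.Quotient.algebraMap_eq, Ideal.Quotient.eq_zero_iff_mem]
      exact Ideal.mem_map_of_mem _ ht
    induction v using TensorProduct.induction_on with
    | zero => rw [smul_zero]
    | add x y hx hy => rw [smul_add, hx, hy, add_zero]
    | tmul y c =>
      have hc : (algebraMap T C t) • c = 0 := by
        apply Subtype.ext
        rw [Submodule.coe_smul_of_tower, Submodule.coe_zero, Algebra.smul_def, hct, zero_mul]
      rw [TensorProduct.smul_tmul', ← algebraMap_smul C t y, TensorProduct.smul_tmul, hc,
        TensorProduct.tmul_zero]
  obtain ⟨t, htp, htz⟩ := exists_smul_eq_zero_of_tmul_one_eq_zero p hk hV z h4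
  refine ⟨⟨algebraMap T P t, fun h => htp ?_⟩, ?_⟩
  · rw [← hQ, Ideal.mem_comap]
    exact h
  · change algebraMap T P t • z = 0
    rwa [algebraMap_smul]

include hQ hk E in
/-- **The fibrewise criterion at a Noetherian level** (The Stacks Project, Tag 00MP, in the form
used by the limit argument of Tag 00R7): with the data of this section, if `C` and `P` are
Noetherian and `P_Q` is flat over `T`, then `P_Q` is flat over `C`. Proof: the local criterion
`flat_of_le_jacobson` over `C` with `J = 𝔭C`: `JP_Q ⊆ QP_Q = rad P_Q`; `P_Q ⊗_C 𝔭C → P_Q` is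
injective because `P_Q ⊗_T 𝔭 → P_Q ⊗_C 𝔭C` is onto and `P_Q ⊗_T 𝔭 → P_Q` is injective
("As `M` is flat over `R` the composition is injective and so both arrows are injective",
Tag 00MP); and `P_Q/𝔭P_Q` is flat over `C/𝔭C` by `injective_lTensor_localization_fibre`.
[cite: StacksProject, Tag 00MP] -/
theorem flat_localization_of_flat_of_fibre [IsNoetherianRing C] [IsNoetherianRing P]
    [Module.Flat T (Localization.AtPrime Q)] : Module.Flat C (Localization.AtPrime Q) := by
  let N := Localization.AtPrime Q
  let J : Ideal C := p.map (algebraMap T C)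
  haveI : IsNoetherianRing N := IsLocalization.isNoetherianRing Q.primeCompl N inferInstance
  refine flat_of_le_jacobson (R := C) (B := N) (N := N) J ?_ ?_ ?_
  · -- `𝔭C P_Q ⊆ Q P_Q`
    refine le_trans ?_ (IsLocalRing.maximalIdeal_le_jacobson ⊥)
    rw [Ideal.map_map, ← IsScalarTower.algebraMap_eq, Ideal.map_le_iff_le_comap]
    intro t ht
    rw [Ideal.mem_comap, ← Localization.AtPrime.map_eq_maximalIdeal,
      IsScalarTower.algebraMap_apply T P N]
    apply Ideal.mem_map_of_mem
    change t ∈ Q.comap (algebraMap T P)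
    rw [hQ]
    exact ht
  · -- `Tor₁^C(C/𝔭C, P_Q) = 0`
    exact injective_lTensor_subtype_map_of_flat (R := T) (R' := C) p N
  · intro 𝔠
    exact injective_lTensor_localization_fibre p Q hQ hk E 𝔠

end Level

end Literature.RingTheory.Flat
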